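import Literature.AlgebraicGeometry.Hu2025.Proofs.S03Pluecker.GammaQuadCellDomain
import HarnessLib

/-!
# Hu 2025 / [Hu22] p.131 — the TORUS on the thin Schubert cell of the complete quadrilateral: scaling endomorphisms,
# the torus NORMALISATION `ν`, the normal-form SLICE `Rh ⧸ J ≅ Gr_d/(𝔾⁹_m/𝔾_m)` and its integrality
# (joint J1 / GAP-LEDGER-HU row HU-R01, reading (β) «as printed with (a) + (b)» — kernel support, OURS)

**HONEST FRAMING (D-0012/D-0089).** [Hu2025] (arXiv:2507.21400v1) and [Hu2022] (arXiv:2203.03842v4) are unrefereed preprints under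
adjudication; nothing of them is asserted. OURS objects only, on the typed carriers of rows 101/109/110:
`Rh = (k[x_u] ⧸ ((𝓕_m) + (x̄_u : u ∈ Γ)))[1/∏_{u ∉ Γ} x̄_u]` is the coordinate ring of the open matroid Schubert cell `Gr_d = Gr^{3,E}_d`
of the complete quadrilateral (`Γ = Γ_d = {456, 478, 579, 689}`, `n = 9`; `GammaQuadCellDomain`), with universal matrix `[I₃ | A]`,
`A a = (m(23a), −m(13a), m(12a))`.

[Hu22] p.131 l.6–16 (proof of Thm 9.5) reads: «We identify `U ⊂ X × 𝔸^r` with the quotient space `Gr̄^{3,E}_d = Gr^{3,E}_d/(𝔾ⁿ_m/𝔾_m)`.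
Consider the quotient map `π : Gr^{3,E}_d → Gr̄^{3,E}_d`», after Thm 9.4 (p.130 l.39–50) «`(𝔾ⁿ_m/𝔾_m)` acts freely on the matroid
Schubert cell `Gr^{3,E}_d` … `U` is isomorphic to the quotient space `Gr̄^{3,E}_d := Gr^{3,E}_d/(𝔾ⁿ_m/𝔾_m)`». This file gives
that quotient for `d = quad` a kernel carrier:

* `scale σ : Rh →+* Rh` for column weights `σ : ℕ → Rhˣ` — the action of the torus element `(σ₁, …, σ₉)` on the chart
  coordinates, `x̄_u ↦ (σ_{u₁}σ_{u₂}σ_{u₃}/σ₁σ₂σ₃) · x̄_u` (it preserves the Γ-scheme ideal: the Plücker minors are multi-homogeneous,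
  `scale_m`, and acts on the matrix entries by `A_{a,i} ↦ (σ_a/σ_{i+1}) A_{a,i}`, `scale_A`);
* the NORMALISING weights `τ(A)` (`τ₁ = A₄₀, τ₂ = A₄₁, τ₃ = A₄₂, τ_a = A₄₀/A_{a0}`) and the torus normalisation `ν := scale τ`:
  `ν(A_{a0}) = 1` (`a = 4..9`), `ν(A_{41}) = ν(A_{42}) = 1` (`ν_A_row0`, `ν_A_four`) — `ν` sends the universal matrix to its
  NORMAL FORM `τ(A)·A` in its own torus orbit;
* the SLICE ideal `J = (A_{a0} − 1 (a = 4..9), A_{41} − 1, A_{42} − 1)`, `ν(J) = 0`, the induced `πJ : Rh ⧸ J → Rh` with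
  `mk_J ∘ πJ = id` (`mk_comp_πJ`): the slice `Spec (Rh ⧸ J)` is a RETRACT of the cell along `ν`; every torus orbit meets it in
  its normal form; hence `Rh ⧸ J` is a DOMAIN (`isDomain_slice`, `k` of characteristic `0`) — the coordinate ring of
  `Gr_d/(𝔾⁹_m/𝔾_m)` realised as the normal-form slice, with quotient map `Spec ν̄ = Spec πJ`;
* (T-invariance of the quotient map under constant torus elements is recorded in the sequel file `GammaQuadTorusInvariance.lean`.)

The scheme-level inhabitant of row 110's records built from this is `Proofs/S01S09Interface/GammaQuadHu22SetupTorus.lean`.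
AI proof is weaker than expert review.
-/

noncomputable section

namespace Literature.AlgebraicGeometry.Hu2025.Statements.S03Pluecker

open MvPolynomial Matrix

namespace QuadTorus

open QuadCell

variable (k : Type) [Field k]

/-! ## Bookkeeping: the matrix entries `A a i` (`4 ≤ a ≤ 9`) are units of `Rh` -/

/-- `(2,3,a), (1,3,a), (1,2,a)` are off `Γ` for `3 < a ≤ 9`.
[cite: Hu2025, Prop. 9.1 (Gr_d: «p_u ≠ 0, ∀ x_u ∈ Δ_d») p.160; joint J1 = GAP-LEDGER-HU row HU-R01 (unrefereed preprint arXiv:2507.21400v1 under adjudication, D-0012/D-0089 — kernel support on OUR typed carriers of rows 101/110; nothing of the source asserted)] -/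
theorem mem_offGamma_basic {a : ℕ} (ha : 3 < a) (ha9 : a ≤ 9) :
    ((2, 3, a) : ℕ × ℕ × ℕ) ∈ offGamma ∧ ((1, 3, a) : ℕ × ℕ × ℕ) ∈ offGamma ∧ ((1, 2, a) : ℕ × ℕ × ℕ) ∈ offGamma := by
  refine ⟨?_, ?_, ?_⟩
  · refine Finset.mem_filter.mpr ⟨mem_plVarSet (by norm_num) (by norm_num) ha ha9 ha, ?_⟩
    simp [quadGammaFin]
  · refine Finset.mem_filter.mpr ⟨mem_plVarSet (by norm_num) (by norm_num) ha ha9 ha, ?_⟩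
    simp [quadGammaFin]
  · refine Finset.mem_filter.mpr ⟨mem_plVarSet (by norm_num) (by norm_num) (by omega) ha9 ha, ?_⟩
    simp [quadGammaFin]

/-- **Every entry `A a i` (`3 < a ≤ 9`) of the universal matrix is a UNIT of the cell ring** (it is `± x̄_u` for a non-`Γ` triple `u`).
[cite: Hu2025, Prop. 9.1 (Gr_d: «p_u ≠ 0, ∀ x_u ∈ Δ_d») p.160; joint J1 = GAP-LEDGER-HU row HU-R01 (unrefereed preprint arXiv:2507.21400v1 under adjudication, D-0012/D-0089 — kernel support on OUR typed carriers of rows 101/110; nothing of the source asserted)] -/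
theorem isUnit_A {a : ℕ} (ha : 3 < a) (ha9 : a ≤ 9) (i : Fin 3) : IsUnit (A k a i) := by
  obtain ⟨h23, h13, h12⟩ := mem_offGamma_basic ha ha9
  rw [A_of_lt k ha ha9]
  fin_cases i
  · simpa using isUnit_m k h23
  · simpa using (isUnit_m k h13).neg
  · simpa using isUnit_m k h12

/-! ## The torus action on the cell ring: `scale σ` for column weights `σ : ℕ → Rhˣ` -/

section Scale

variable (σ : ℕ → (Rh k)ˣ)

/-- Row weights `r_i = σ_{i+1}⁻¹` (the renormalisation of `[diag(σ₁,σ₂,σ₃) | ⋯]` back to `[I₃ | ⋯]`). OURS.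
[cite: Hu2025, Thm. 9.3/9.4 («the action of 𝔾ⁿ_m/𝔾_m on Gr^{d,n}_d») p.160–161; [Hu22] p.131 l.6–16; joint J1 = GAP-LEDGER-HU row HU-R01 (unrefereed preprints under adjudication, D-0012/D-0089 — kernel support on OUR typed carriers of rows 101/110; nothing of the sources asserted)] -/
def rw (i : Fin 3) : Rh k :=
  match i with
  | 0 => ((σ 1)⁻¹ : (Rh k)ˣ)
  | 1 => ((σ 2)⁻¹ : (Rh k)ˣ)
  | 2 => ((σ 3)⁻¹ : (Rh k)ˣ)

/-- The weight of the chart coordinate `x̄_t`: `c_t = r₀ r₁ r₂ σ_{t₁} σ_{t₂} σ_{t₃} = σ_{t₁}σ_{t₂}σ_{t₃}/(σ₁σ₂σ₃)`. OURS.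
[cite: Hu2025, Thm. 9.3/9.4 («the action of 𝔾ⁿ_m/𝔾_m on Gr^{d,n}_d») p.160–161; [Hu22] p.131 l.6–16; joint J1 = GAP-LEDGER-HU row HU-R01 (unrefereed preprints under adjudication, D-0012/D-0089 — kernel support on OUR typed carriers of rows 101/110; nothing of the sources asserted)] -/
def cw (t : ℕ × ℕ × ℕ) : Rh k := rw k σ 0 * rw k σ 1 * rw k σ 2 * σ t.1 * σ t.2.1 * σ t.2.2

/-- `r_i σ_{i+1} = 1`.
[cite: Hu2025, Thm. 9.3/9.4 p.160–161; [Hu22] p.131 l.6–16; joint J1 = GAP-LEDGER-HU row HU-R01 (unrefereed preprints under adjudication, D-0012/D-0089 — kernel support on OUR typed carriers of rows 101/110; nothing of the sources asserted)] -/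
theorem rw_mul : rw k σ 0 * σ 1 = 1 ∧ rw k σ 1 * σ 2 = 1 ∧ rw k σ 2 * σ 3 = 1 :=
  ⟨(σ 1).inv_mul, (σ 2).inv_mul, (σ 3).inv_mul⟩

/-- `r_i` is a unit.
[cite: Hu2025, Thm. 9.3/9.4 p.160–161; [Hu22] p.131 l.6–16; joint J1 = GAP-LEDGER-HU row HU-R01 (unrefereed preprints under adjudication, D-0012/D-0089 — kernel support on OUR typed carriers of rows 101/110; nothing of the sources asserted)] -/
theorem isUnit_rw (i : Fin 3) : IsUnit (rw k σ i) := by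
  fin_cases i <;> exact Units.isUnit _

/-- Two functions on `Fin 3` agree if they agree at `0, 1, 2`.
[cite: Hu2025, Thm. 9.3/9.4 p.160–161; joint J1 = GAP-LEDGER-HU row HU-R01 (unrefereed preprints under adjudication, D-0012/D-0089 — kernel support on OUR typed carriers of rows 101/110; nothing of the sources asserted)] -/
theorem vec3_eq {R : Type*} {f g : Fin 3 → R} (h0 : f 0 = g 0) (h1 : f 1 = g 1) (h2 : f 2 = g 2) : f = g := by
  funext i
  fin_cases i
  · exact h0
  · exact h1
  · exact h2

/-- `c_t` is a unit.
[cite: Hu2025, Thm. 9.3/9.4 p.160–161; [Hu22] p.131 l.6–16; joint J1 = GAP-LEDGER-HU row HU-R01 (unrefereed preprints under adjudication, D-0012/D-0089 — kernel support on OUR typed carriers of rows 101/110; nothing of the sources asserted)] -/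
theorem isUnit_cw (t : ℕ × ℕ × ℕ) : IsUnit (cw k σ t) := by
  unfold cw
  exact ((((((isUnit_rw k σ 0).mul (isUnit_rw k σ 1)).mul (isUnit_rw k σ 2)).mul (Units.isUnit _)).mul
    (Units.isUnit _)).mul (Units.isUnit _))

/-- **The scaled evaluation of the basic variables**: `x_{(ij a)} ↦ c_{(ij a)} · x̄_{(ij a)}`. OURS.
[cite: Hu2025, Thm. 9.3/9.4 («the action of 𝔾ⁿ_m/𝔾_m on Gr^{d,n}_d») p.160–161 / Prop. 3.6 (k[Var_𝕌]) p.38; [Hu22] p.131 l.6–16; joint J1 = GAP-LEDGER-HU row HU-R01 (unrefereed preprints under adjudication, D-0012/D-0089 — kernel support on OUR typed carriers of rows 101/110; nothing of the sources asserted)] -/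
def ψσ : BasicRing 9 k →ₐ[k] Rh k :=
  MvPolynomial.aeval fun x => cw k σ x.1.1 * toRh k (basicIncl 9 k (X x))

/-- `ψσ` on a basic variable.
[cite: Hu2025, Thm. 9.3/9.4 p.160–161 / Prop. 3.6 p.38; joint J1 = GAP-LEDGER-HU row HU-R01 (unrefereed preprints under adjudication, D-0012/D-0089 — kernel support on OUR typed carriers of rows 101/110; nothing of the sources asserted)] -/
theorem ψσ_bvar {t : ℕ × ℕ × ℕ} (h : t ∈ plVarSet 9) (hb : ¬ IsLt t) : ψσ k σ (bvar k t) = cw k σ t * m k t := by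
  rw [bvar_of_mem k h hb, ψσ, MvPolynomial.aeval_X, ← bvar_of_mem k h hb, basicIncl_bvar k h hb]
  rfl

/-- **`ψσ ∘ chartCol a = (r_i σ_a A_{a,i})_i`** for `1 ≤ a ≤ 9`: the torus acts on the matrix entries by row and column weights.
[cite: Hu2025, Thm. 9.3/9.4 («the action of 𝔾ⁿ_m/𝔾_m on Gr^{d,n}_d») p.160–161 / Prop. 3.6 p.38; [Hu22] p.131 l.6–16; joint J1 = GAP-LEDGER-HU row HU-R01 (unrefereed preprints under adjudication, D-0012/D-0089 — kernel support on OUR typed carriers of rows 101/110; nothing of the sources asserted)] -/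
theorem ψσ_chartCol {a : ℕ} (ha1 : 1 ≤ a) (ha9 : a ≤ 9) :
    (ψσ k σ) ∘ chartCol k a = fun i => (rw k σ i * σ a) * A k a i := by
  obtain ⟨h1, h2, h3⟩ := rw_mul k σ
  by_cases ha : 3 < a
  · have h23 : ((2, 3, a) : ℕ × ℕ × ℕ) ∈ plVarSet 9 := mem_plVarSet (by norm_num) (by norm_num) ha ha9 ha
    have h13 : ((1, 3, a) : ℕ × ℕ × ℕ) ∈ plVarSet 9 := mem_plVarSet (by norm_num) (by norm_num) ha ha9 ha
    have h12 : ((1, 2, a) : ℕ × ℕ × ℕ) ∈ plVarSet 9 := mem_plVarSet (by norm_num) (by norm_num) (by omega) ha9 ha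
    have n23 : ¬ IsLt ((2, 3, a) : ℕ × ℕ × ℕ) := not_isLt_of_le (by norm_num) (by norm_num) le_rfl
    have n13 : ¬ IsLt ((1, 3, a) : ℕ × ℕ × ℕ) := not_isLt_of_le (by norm_num) (by norm_num) le_rfl
    have n12 : ¬ IsLt ((1, 2, a) : ℕ × ℕ × ℕ) := not_isLt_of_le (by norm_num) (by norm_num) (by norm_num)
    rw [chartCol_of_lt k ha, A_of_lt k ha ha9]
    refine vec3_eq ?_ ?_ ?_
    · simp only [Function.comp_apply, Matrix.cons_val_zero, ψσ_bvar k σ h23 n23, cw]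
      linear_combination (rw k σ 0 * (σ a : Rh k) * m k (2, 3, a) * rw k σ 2 * (σ 3 : Rh k)) * h2 +
        (rw k σ 0 * (σ a : Rh k) * m k (2, 3, a)) * h3
    · simp only [Function.comp_apply, Matrix.cons_val_one, Matrix.cons_val_zero, map_neg, ψσ_bvar k σ h13 n13, cw]
      linear_combination (-(rw k σ 1 * (σ a : Rh k) * m k (1, 3, a) * rw k σ 2 * (σ 3 : Rh k))) * h1 -
        (rw k σ 1 * (σ a : Rh k) * m k (1, 3, a)) * h3
    · simp only [Function.comp_apply, Matrix.cons_val_two, Matrix.tail_cons, Matrix.head_cons, ψσ_bvar k σ h12 n12,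
        cw]
      linear_combination (rw k σ 2 * (σ a : Rh k) * m k (1, 2, a) * rw k σ 1 * (σ 2 : Rh k)) * h1 +
        (rw k σ 2 * (σ a : Rh k) * m k (1, 2, a)) * h2
  · obtain ⟨f1, f2, f3⟩ := A_frame k
    have ha' : a = 1 ∨ a = 2 ∨ a = 3 := by omega
    rcases ha' with rfl | rfl | rfl
    · rw [chartCol_one, f1]; refine vec3_eq ?_ ?_ ?_ <;> simp [h1]
    · rw [chartCol_two, f2]; refine vec3_eq ?_ ?_ ?_ <;> simp [h2]
    · rw [chartCol_three, f3]; refine vec3_eq ?_ ?_ ?_ <;> simp [h3]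

/-- `det3` under row weights `r` and column weights `s₁, s₂, s₃`.
[cite: Hu2025, Thm. 9.3/9.4 p.160–161 / Prop. 3.6 p.38; joint J1 = GAP-LEDGER-HU row HU-R01 (unrefereed preprints under adjudication, D-0012/D-0089 — kernel support on OUR typed carriers of rows 101/110; nothing of the sources asserted)] -/
theorem det3_weights {R : Type*} [CommRing R] (r : Fin 3 → R) (s₁ s₂ s₃ : R) (v w x : Fin 3 → R) :
    det3 (fun i => r i * s₁ * v i) (fun i => r i * s₂ * w i) (fun i => r i * s₃ * x i) =
      r 0 * r 1 * r 2 * s₁ * s₂ * s₃ * det3 v w x := by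
  simp only [det3_eq]
  ring

/-- **The chart minors are multi-homogeneous under the torus**: `ψσ (chartMinor u) = c_u · det(A_{u₁}, A_{u₂}, A_{u₃})`.
[cite: Hu2025, Thm. 9.3/9.4 («the action of 𝔾ⁿ_m/𝔾_m on Gr^{d,n}_d») p.160–161 / Prop. 3.6 p.38; [Hu22] p.131 l.6–16; joint J1 = GAP-LEDGER-HU row HU-R01 (unrefereed preprints under adjudication, D-0012/D-0089 — kernel support on OUR typed carriers of rows 101/110; nothing of the sources asserted)] -/
theorem ψσ_chartMinor {u : ℕ × ℕ × ℕ} (hu : u ∈ plIndexSet 9) :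
    ψσ k σ (chartMinor k u) = cw k σ u * det3 (A k u.1) (A k u.2.1) (A k u.2.2) := by
  have hidx := mem_plIndexSet_iff.mp hu
  have h := map_det3 (ψσ k σ).toRingHom (chartCol k u.1) (chartCol k u.2.1) (chartCol k u.2.2)
  rw [AlgHom.toRingHom_eq_coe, RingHom.coe_coe] at h
  rw [chartMinor]
  erw [h]
  rw [ψσ_chartCol k σ (a := u.1) (by omega) (by omega), ψσ_chartCol k σ (a := u.2.1) (by omega) (by omega),
    ψσ_chartCol k σ (a := u.2.2) (by omega) (by omega), det3_weights, cw]

/-- **`scale₀ σ : k[x_u] → Rh`**, `x_u ↦ c_u · x̄_u` (`= ψσ ∘ chartParam`). OURS.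
[cite: Hu2025, Thm. 9.3/9.4 («the action of 𝔾ⁿ_m/𝔾_m on Gr^{d,n}_d») p.160–161 / Prop. 3.6 p.38; [Hu22] p.131 l.6–16; joint J1 = GAP-LEDGER-HU row HU-R01 (unrefereed preprints under adjudication, D-0012/D-0089 — kernel support on OUR typed carriers of rows 101/110; nothing of the sources asserted)] -/
def scale₀ : ChartRing 9 k →ₐ[k] Rh k := (ψσ k σ).comp (chartParam 9 k)

/-- `scale₀ (x̄_u) = c_u · m u` for chart indices `u`.
[cite: Hu2025, Thm. 9.3/9.4 p.160–161 / Prop. 3.6 p.38; joint J1 = GAP-LEDGER-HU row HU-R01 (unrefereed preprints under adjudication, D-0012/D-0089 — kernel support on OUR typed carriers of rows 101/110; nothing of the sources asserted)] -/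
theorem scale₀_xbar {u : ℕ × ℕ × ℕ} (hu : u ∈ plVarSet 9) : scale₀ k σ (xbar k u) = cw k σ u * m k u := by
  rw [scale₀, AlgHom.comp_apply, chartParam_xbar k hu, ψσ_chartMinor k σ (Finset.mem_erase.mp hu).2, ← m_eq_det3 k hu]

/-- **`scale₀` kills the Γ-scheme ideal** `(𝓕_m) + (x̄_u : u ∈ Γ)` (the torus preserves `Z_Γ` and the cell).
[cite: Hu2025, Def. 7.1 (I_{℘,Γ}) p.128 / Prop. 3.6 p.38 / Thm. 9.3/9.4 p.160–161; [Hu22] p.131 l.6–16; joint J1 = GAP-LEDGER-HU row HU-R01 (unrefereed preprints under adjudication, D-0012/D-0089 — kernel support on OUR typed carriers of rows 101/110; nothing of the sources asserted)] -/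
theorem scale₀_gammaChartIdeal : ∀ F ∈ gammaChartIdeal k 9 quadGamma, scale₀ k σ F = 0 := by
  intro F hF
  rw [mem_gammaChartIdeal_iff k (quadGamma_subset le_rfl)] at hF
  have hle : gammaMinorIdeal k 9 quadGamma ≤ RingHom.ker (ψσ k σ).toRingHom := by
    unfold gammaMinorIdeal
    rw [Ideal.span_le]
    rintro _ ⟨u, hu, rfl⟩
    have hu' : u ∈ plVarSet 9 := quadGamma_subset le_rfl hu
    rw [SetLike.mem_coe, RingHom.mem_ker, AlgHom.toRingHom_eq_coe, RingHom.coe_coe,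
      ψσ_chartMinor k σ (Finset.mem_erase.mp hu').2, ← m_eq_det3 k hu', m_gamma k hu, mul_zero]
  have := hle hF
  rw [RingHom.mem_ker, AlgHom.toRingHom_eq_coe, RingHom.coe_coe] at this
  rw [scale₀, AlgHom.comp_apply]
  exact this

/-- **`scale_q σ : Rq → Rh`**. OURS.
[cite: Hu2025, Def. 7.1 (Z_Γ) p.128 / Thm. 9.3/9.4 p.160–161; [Hu22] p.131 l.6–16; joint J1 = GAP-LEDGER-HU row HU-R01 (unrefereed preprints under adjudication, D-0012/D-0089 — kernel support on OUR typed carriers of rows 101/110; nothing of the sources asserted)] -/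
def scaleq : Rq k →+* Rh k :=
  Ideal.Quotient.lift (gammaChartIdeal k 9 quadGamma) (scale₀ k σ).toRingHom
    (fun F hF => by rw [AlgHom.toRingHom_eq_coe, RingHom.coe_coe]; exact scale₀_gammaChartIdeal k σ F hF)

/-- `scale_q σ (hq)` is a unit.
[cite: Hu2025, Prop. 9.1 (Gr_d) p.160 / Thm. 9.3/9.4 p.160–161; joint J1 = GAP-LEDGER-HU row HU-R01 (unrefereed preprints under adjudication, D-0012/D-0089 — kernel support on OUR typed carriers of rows 101/110; nothing of the sources asserted)] -/
theorem isUnit_scaleq_hq : IsUnit (scaleq k σ (hq k)) := by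
  show IsUnit (scaleq k σ (Ideal.Quotient.mk _ (hprod k)))
  rw [scaleq, Ideal.Quotient.lift_mk, AlgHom.toRingHom_eq_coe, RingHom.coe_coe, hprod, map_prod, IsUnit.prod_iff]
  intro u hu
  rw [scale₀_xbar k σ (Finset.mem_filter.mp hu).1]
  exact (isUnit_cw k σ u).mul (isUnit_m k hu)

/-- **`scale σ : Rh → Rh`** — the action of the torus element with column weights `σ` on the coordinate ring of the cell
(`x̄_u ↦ (σ_{u₁}σ_{u₂}σ_{u₃}/σ₁σ₂σ₃) x̄_u`). OURS.
[cite: Hu2025, Thm. 9.3/9.4 («the action of 𝔾ⁿ_m/𝔾_m on Gr^{d,n}_d … acts freely on the matroid Schubert cell») p.160–161; [Hu22] p.131 l.6–16 («the quotient map π : Gr_d → Gr̄_d = Gr_d/(𝔾ⁿ_m/𝔾_m)»); joint J1 = GAP-LEDGER-HU row HU-R01 (unrefereed preprints under adjudication, D-0012/D-0089 — kernel support on OUR typed carriers of rows 101/110; nothing of the sources asserted)] -/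
def scale : Rh k →+* Rh k := IsLocalization.Away.lift (hq k) (isUnit_scaleq_hq k σ)

/-- `scale σ (toRh F) = scale₀ σ F`.
[cite: Hu2025, Thm. 9.3/9.4 p.160–161; joint J1 = GAP-LEDGER-HU row HU-R01 (unrefereed preprints under adjudication, D-0012/D-0089 — kernel support on OUR typed carriers of rows 101/110; nothing of the sources asserted)] -/
theorem scale_toRh (F : ChartRing 9 k) : scale k σ (toRh k F) = scale₀ k σ F := by
  rw [toRh, RingHom.comp_apply, scale, IsLocalization.Away.lift_eq, scaleq, Ideal.Quotient.lift_mk,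
    AlgHom.toRingHom_eq_coe, RingHom.coe_coe]

/-- **`scale σ (m u) = c_u · m u`** for chart indices `u`.
[cite: Hu2025, Thm. 9.3/9.4 («the action of 𝔾ⁿ_m/𝔾_m on Gr^{d,n}_d») p.160–161; [Hu22] p.131 l.6–16; joint J1 = GAP-LEDGER-HU row HU-R01 (unrefereed preprints under adjudication, D-0012/D-0089 — kernel support on OUR typed carriers of rows 101/110; nothing of the sources asserted)] -/
theorem scale_m {u : ℕ × ℕ × ℕ} (hu : u ∈ plVarSet 9) : scale k σ (m k u) = cw k σ u * m k u := by
  rw [m, scale_toRh, scale₀_xbar k σ hu, m]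

/-- **`scale σ (A_{a,i}) = (r_i σ_a) · A_{a,i}`** (`1 ≤ a ≤ 9`).
[cite: Hu2025, Thm. 9.3/9.4 («the action of 𝔾ⁿ_m/𝔾_m on Gr^{d,n}_d») p.160–161; [Hu22] p.131 l.6–16; joint J1 = GAP-LEDGER-HU row HU-R01 (unrefereed preprints under adjudication, D-0012/D-0089 — kernel support on OUR typed carriers of rows 101/110; nothing of the sources asserted)] -/
theorem scale_A {a : ℕ} (ha1 : 1 ≤ a) (ha9 : a ≤ 9) (i : Fin 3) :
    scale k σ (A k a i) = (rw k σ i * σ a) * A k a i := by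
  have h := congrFun (ψσ_chartCol k σ ha1 ha9) i
  rw [Function.comp_apply] at h
  rw [A, Function.comp_apply, Function.comp_apply, scale_toRh, scale₀, AlgHom.comp_apply, chartParam_basicIncl, h, A,
    Function.comp_apply, Function.comp_apply]

/-- `scale σ` on constants.
[cite: Hu2025, Thm. 9.3/9.4 p.160–161; joint J1 = GAP-LEDGER-HU row HU-R01 (unrefereed preprints under adjudication, D-0012/D-0089 — kernel support on OUR typed carriers of rows 101/110; nothing of the sources asserted)] -/
theorem toRh_C (c : k) : toRh k (C c) = algebraMap k (Rh k) c := by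
  rw [toRh, RingHom.comp_apply, ← MvPolynomial.algebraMap_eq, ← Ideal.Quotient.algebraMap_eq,
    ← IsScalarTower.algebraMap_apply, ← IsScalarTower.algebraMap_apply]

/-- `scale σ` fixes constants.
[cite: Hu2025, Thm. 9.3/9.4 p.160–161; joint J1 = GAP-LEDGER-HU row HU-R01 (unrefereed preprints under adjudication, D-0012/D-0089 — kernel support on OUR typed carriers of rows 101/110; nothing of the sources asserted)] -/
theorem scale_toRh_C (c : k) : scale k σ (toRh k (C c)) = toRh k (C c) := by
  rw [scale_toRh, ← MvPolynomial.algebraMap_eq, AlgHom.commutes, MvPolynomial.algebraMap_eq, toRh_C]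

end Scale

/-! ## The normalising torus element `τ(A)` and the torus normalisation `ν = scale τ` -/

/-- The unit `A_{a,i}` of `Rh` (`3 < a ≤ 9`), junk `1` off range. OURS plumbing.
[cite: Hu2025, Prop. 9.1 (Gr_d: «p_u ≠ 0, ∀ x_u ∈ Δ_d») p.160; joint J1 = GAP-LEDGER-HU row HU-R01 (unrefereed preprint arXiv:2507.21400v1 under adjudication, D-0012/D-0089 — kernel support on OUR typed carriers of rows 101/110; nothing of the source asserted)] -/
def uA (a : ℕ) (i : Fin 3) : (Rh k)ˣ :=
  if h : 3 < a ∧ a ≤ 9 then (isUnit_A k h.1 h.2 i).unit else 1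

/-- `uA a i = A a i` in range.
[cite: Hu2025, Prop. 9.1 (Gr_d) p.160; joint J1 = GAP-LEDGER-HU row HU-R01 (unrefereed preprint arXiv:2507.21400v1 under adjudication, D-0012/D-0089 — kernel support on OUR typed carriers of rows 101/110; nothing of the source asserted)] -/
theorem coe_uA {a : ℕ} (ha : 3 < a) (ha9 : a ≤ 9) (i : Fin 3) : (uA k a i : Rh k) = A k a i := by
  rw [uA, dif_pos ⟨ha, ha9⟩, IsUnit.unit_spec]

/-- **The NORMALISING torus element `τ(A)`**: column weights `τ₁ = A₄₀`, `τ₂ = A₄₁`, `τ₃ = A₄₂`, `τ_a = A₄₀ · A_{a0}⁻¹`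
(`4 ≤ a ≤ 9`), `1` otherwise — the unique (up to the diagonal `𝔾_m`) torus element taking `[I₃ | A]` to its NORMAL FORM (first row
of `A` and the column `a₄` all equal to `1`). OURS.
[cite: Hu2025, Thm. 9.4 («(𝔾ⁿ_m/𝔾_m) acts freely on the matroid Schubert cell») p.161; [Hu22] p.131 l.6–16 («the quotient map π : Gr_d → Gr_d/(𝔾ⁿ_m/𝔾_m)»); joint J1 = GAP-LEDGER-HU row HU-R01 (unrefereed preprints under adjudication, D-0012/D-0089 — kernel support on OUR typed carriers of rows 101/110; nothing of the sources asserted)] -/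
def τ (a : ℕ) : (Rh k)ˣ :=
  if a = 1 then uA k 4 0 else if a = 2 then uA k 4 1 else if a = 3 then uA k 4 2
  else if 4 ≤ a ∧ a ≤ 9 then uA k 4 0 * (uA k a 0)⁻¹ else 1

/-- **The torus NORMALISATION `ν := scale τ : Rh → Rh`** — pull-back along `A ↦ τ(A) · A` (each matrix to the normal form in its
own torus orbit). Its image is the ring of torus invariants realised on the slice; see `πJ`. OURS.
[cite: Hu2025, Thm. 9.4 p.161; [Hu22] p.131 l.6–16 («We identify U … with the quotient space Gr_d/(𝔾ⁿ_m/𝔾_m). Consider the quotient map π»); joint J1 = GAP-LEDGER-HU row HU-R01 (unrefereed preprints under adjudication, D-0012/D-0089 — kernel support on OUR typed carriers of rows 101/110; nothing of the sources asserted)] -/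
def ν : Rh k →+* Rh k := scale k (τ k)

/-- **Normal form, first row**: `ν (A_{a,0}) = 1` for `4 ≤ a ≤ 9`.
[cite: Hu2025, Thm. 9.4 p.161; [Hu22] p.131 l.6–16; joint J1 = GAP-LEDGER-HU row HU-R01 (unrefereed preprints under adjudication, D-0012/D-0089 — kernel support on OUR typed carriers of rows 101/110; nothing of the sources asserted)] -/
theorem ν_A_row0 {a : ℕ} (ha : 3 < a) (ha9 : a ≤ 9) : ν k (A k a 0) = 1 := by
  rw [ν, scale_A k (τ k) (by omega) ha9, rw]
  have e1 : τ k 1 = uA k 4 0 := by simp [τ]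
  have e2 : τ k a = uA k 4 0 * (uA k a 0)⁻¹ := by
    unfold τ
    rw [if_neg (by omega), if_neg (by omega), if_neg (by omega), if_pos ⟨by omega, ha9⟩]
  rw [e1, e2, ← coe_uA k ha ha9 0, Units.val_mul, ← mul_assoc, Units.inv_mul, one_mul, Units.inv_mul]

/-- **Normal form, column `a₄`**: `ν (A_{4,i}) = 1` for every `i`.
[cite: Hu2025, Thm. 9.4 p.161; [Hu22] p.131 l.6–16; joint J1 = GAP-LEDGER-HU row HU-R01 (unrefereed preprints under adjudication, D-0012/D-0089 — kernel support on OUR typed carriers of rows 101/110; nothing of the sources asserted)] -/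
theorem ν_A_four (i : Fin 3) : ν k (A k 4 i) = 1 := by
  have e2 : τ k 4 = 1 := by
    unfold τ
    rw [if_neg (by omega), if_neg (by omega), if_neg (by omega), if_pos ⟨le_rfl, by omega⟩, mul_inv_cancel]
  rw [ν, scale_A k (τ k) (by omega) (by omega), e2, Units.val_one, mul_one]
  have e1 : τ k 1 = uA k 4 0 ∧ τ k 2 = uA k 4 1 ∧ τ k 3 = uA k 4 2 := by simp [τ]
  fin_cases i
  · show ((τ k 1)⁻¹ : (Rh k)ˣ) * A k 4 0 = 1
    rw [e1.1, ← coe_uA k (by omega) (by omega) 0, Units.inv_mul]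
  · show ((τ k 2)⁻¹ : (Rh k)ˣ) * A k 4 1 = 1
    rw [e1.2.1, ← coe_uA k (by omega) (by omega) 1, Units.inv_mul]
  · show ((τ k 3)⁻¹ : (Rh k)ˣ) * A k 4 2 = 1
    rw [e1.2.2, ← coe_uA k (by omega) (by omega) 2, Units.inv_mul]

/-! ## The normal-form SLICE `J`, the quotient map `πJ : Rh ⧸ J → Rh` and the retraction -/

/-- **The SLICE ideal `J = (A_{a,0} − 1 (a = 4..9), A_{4,1} − 1, A_{4,2} − 1) ⊂ Rh`**: the normal-form locus
`{[I₃|A] ∈ Gr_d : A_{1j} = 1 (j = 4..9), A_{24} = A_{34} = 1}`, which meets every orbit of the free torus `𝔾⁹_m/𝔾_m` exactly in its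
normal form — our carrier of `Gr̄_d = Gr_d/(𝔾ⁿ_m/𝔾_m)`. OURS.
[cite: Hu2025, Thm. 9.4 («U is isomorphic to the quotient space Gr̄_d := Gr_d/(𝔾ⁿ_m/𝔾_m)») p.161; [Hu22] p.131 l.6–16; joint J1 = GAP-LEDGER-HU row HU-R01 (unrefereed preprints under adjudication, D-0012/D-0089 — kernel support on OUR typed carriers of rows 101/110; nothing of the sources asserted)] -/
def J : Ideal (Rh k) :=
  Ideal.span {A k 4 0 - 1, A k 5 0 - 1, A k 6 0 - 1, A k 7 0 - 1, A k 8 0 - 1, A k 9 0 - 1, A k 4 1 - 1, A k 4 2 - 1}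

/-- **`ν` kills the slice ideal** (the normal form satisfies the slice equations).
[cite: Hu2025, Thm. 9.4 p.161; [Hu22] p.131 l.6–16; joint J1 = GAP-LEDGER-HU row HU-R01 (unrefereed preprints under adjudication, D-0012/D-0089 — kernel support on OUR typed carriers of rows 101/110; nothing of the sources asserted)] -/
theorem ν_J : ∀ x ∈ J k, ν k x = 0 := by
  have hle : J k ≤ RingHom.ker (ν k) := by
    unfold J
    rw [Ideal.span_le]
    intro x hx
    simp only [Set.mem_insert_iff, Set.mem_singleton_iff] at hx
    rw [SetLike.mem_coe, RingHom.mem_ker]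
    rcases hx with rfl | rfl | rfl | rfl | rfl | rfl | rfl | rfl
    all_goals rw [map_sub, map_one, sub_eq_zero]
    · exact ν_A_row0 k (by norm_num) (by norm_num)
    · exact ν_A_row0 k (by norm_num) (by norm_num)
    · exact ν_A_row0 k (by norm_num) (by norm_num)
    · exact ν_A_row0 k (by norm_num) (by norm_num)
    · exact ν_A_row0 k (by norm_num) (by norm_num)
    · exact ν_A_row0 k (by norm_num) (by norm_num)
    · exact ν_A_four k 1
    · exact ν_A_four k 2
  intro x hx
  exact RingHom.mem_ker.mp (hle hx)

/-- **The coordinate ring of the slice**, `Rh ⧸ J` — our carrier of `Gr̄_d = Gr_d/(𝔾⁹_m/𝔾_m)` for `d = quad`. OURS.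
[cite: Hu2025, Thm. 9.4 («the quotient space Gr̄_d := Gr_d/(𝔾ⁿ_m/𝔾_m)») p.161; [Hu22] p.131 l.6–16; joint J1 = GAP-LEDGER-HU row HU-R01 (unrefereed preprints under adjudication, D-0012/D-0089 — kernel support on OUR typed carriers of rows 101/110; nothing of the sources asserted)] -/
abbrev Slice : Type := Rh k ⧸ J k

/-- **The quotient map at ring level**: `πJ : Rh ⧸ J → Rh`, induced by `ν` (`Spec πJ : Gr_d → Spec (Rh ⧸ J)` sends a matrix to
its normal form). OURS.
[cite: Hu2025, Thm. 9.4 p.161; [Hu22] p.131 l.6–16 («Consider the quotient map π : Gr_d → Gr̄_d»); joint J1 = GAP-LEDGER-HU row HU-R01 (unrefereed preprints under adjudication, D-0012/D-0089 — kernel support on OUR typed carriers of rows 101/110; nothing of the sources asserted)] -/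
def πJ : Slice k →+* Rh k := Ideal.Quotient.lift (J k) (ν k) (ν_J k)

/-- `πJ ∘ mk = ν`.
[cite: Hu2025, Thm. 9.4 p.161; [Hu22] p.131 l.6–16; joint J1 = GAP-LEDGER-HU row HU-R01 (unrefereed preprints under adjudication, D-0012/D-0089 — kernel support on OUR typed carriers of rows 101/110; nothing of the sources asserted)] -/
theorem πJ_mk (x : Rh k) : πJ k (Ideal.Quotient.mk (J k) x) = ν k x := by
  rw [πJ, Ideal.Quotient.lift_mk]

/-- The slice equations hold modulo `J`: `A_{a,0} ≡ 1` (`4 ≤ a ≤ 9`) and `A_{4,i} ≡ 1`.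
[cite: Hu2025, Thm. 9.4 p.161; [Hu22] p.131 l.6–16; joint J1 = GAP-LEDGER-HU row HU-R01 (unrefereed preprints under adjudication, D-0012/D-0089 — kernel support on OUR typed carriers of rows 101/110; nothing of the sources asserted)] -/
theorem mk_A_eq_one :
    (∀ a, 3 < a → a ≤ 9 → Ideal.Quotient.mk (J k) (A k a 0) = 1) ∧ ∀ i, Ideal.Quotient.mk (J k) (A k 4 i) = 1 := by
  have gen : ∀ x ∈ ({A k 4 0 - 1, A k 5 0 - 1, A k 6 0 - 1, A k 7 0 - 1, A k 8 0 - 1, A k 9 0 - 1, A k 4 1 - 1,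
      A k 4 2 - 1} : Set (Rh k)), Ideal.Quotient.mk (J k) (x + 1) = 1 := by
    intro x hx
    have hxJ : x ∈ J k := Ideal.subset_span hx
    rw [map_add, map_one, Ideal.Quotient.eq_zero_iff_mem.mpr hxJ, zero_add]
  have g : ∀ x : Rh k, x - 1 ∈ ({A k 4 0 - 1, A k 5 0 - 1, A k 6 0 - 1, A k 7 0 - 1, A k 8 0 - 1, A k 9 0 - 1, A k 4 1 - 1,
      A k 4 2 - 1} : Set (Rh k)) → Ideal.Quotient.mk (J k) x = 1 := by
    intro x hx
    have := gen _ hx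
    rwa [sub_add_cancel] at this
  refine ⟨fun a ha ha9 => ?_, fun i => ?_⟩
  · have : a = 4 ∨ a = 5 ∨ a = 6 ∨ a = 7 ∨ a = 8 ∨ a = 9 := by omega
    rcases this with rfl | rfl | rfl | rfl | rfl | rfl <;> exact g _ (by simp)
  · fin_cases i <;> exact g _ (by simp)

/-- A ring map sending a unit to `1` sends its inverse to `1`.
[cite: Hu2025, Thm. 9.4 p.161; joint J1 = GAP-LEDGER-HU row HU-R01 (unrefereed preprints under adjudication, D-0012/D-0089 — kernel support on OUR typed carriers of rows 101/110; nothing of the sources asserted)] -/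
theorem map_units_inv_eq_one {R S : Type*} [CommRing R] [CommRing S] (f : R →+* S) (u : Rˣ) (h : f u = 1) :
    f (u⁻¹ : Rˣ) = 1 := by
  have : f (u⁻¹ : Rˣ) * f u = 1 := by rw [← map_mul, Units.inv_mul, map_one]
  rwa [h, mul_one] at this

/-- Every normalising weight is `≡ 1` modulo `J`.
[cite: Hu2025, Thm. 9.4 p.161; [Hu22] p.131 l.6–16; joint J1 = GAP-LEDGER-HU row HU-R01 (unrefereed preprints under adjudication, D-0012/D-0089 — kernel support on OUR typed carriers of rows 101/110; nothing of the sources asserted)] -/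
theorem mk_τ (a : ℕ) : Ideal.Quotient.mk (J k) (τ k a : Rh k) = 1 := by
  obtain ⟨g0, g4⟩ := mk_A_eq_one k
  have u4 : ∀ i, Ideal.Quotient.mk (J k) (uA k 4 i : Rh k) = 1 := fun i => by
    rw [coe_uA k (by norm_num) (by norm_num)]; exact g4 i
  unfold τ
  split_ifs with h1 h2 h3 h4
  · exact u4 0
  · exact u4 1
  · exact u4 2
  · rw [Units.val_mul, map_mul, u4 0, one_mul]
    apply map_units_inv_eq_one
    rw [coe_uA k (by omega) h4.2]
    exact g0 a (by omega) h4.2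
  · rw [Units.val_one, map_one]

/-- Every weight `c_t(τ)` is `≡ 1` modulo `J`.
[cite: Hu2025, Thm. 9.4 p.161; [Hu22] p.131 l.6–16; joint J1 = GAP-LEDGER-HU row HU-R01 (unrefereed preprints under adjudication, D-0012/D-0089 — kernel support on OUR typed carriers of rows 101/110; nothing of the sources asserted)] -/
theorem mk_cw (t : ℕ × ℕ × ℕ) : Ideal.Quotient.mk (J k) (cw k (τ k) t) = 1 := by
  have hr : ∀ i : Fin 3, Ideal.Quotient.mk (J k) (rw k (τ k) i) = 1 := fun i => by
    fin_cases i <;> exact map_units_inv_eq_one _ _ (mk_τ k _)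
  unfold cw
  simp only [map_mul, hr, mk_τ, mul_one]

/-- **The retraction identity `mk_J ∘ ν = mk_J`**: every function agrees, modulo the slice equations, with its torus-normalised
version (on the slice the normalising weights are all `1`).
[cite: Hu2025, Thm. 9.4 p.161; [Hu22] p.131 l.6–16; joint J1 = GAP-LEDGER-HU row HU-R01 (unrefereed preprints under adjudication, D-0012/D-0089 — kernel support on OUR typed carriers of rows 101/110; nothing of the sources asserted)] -/
theorem mk_comp_ν : (Ideal.Quotient.mk (J k)).comp (ν k) = Ideal.Quotient.mk (J k) := by
  apply IsLocalization.ringHom_ext (Submonoid.powers (hq k))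
  apply Ideal.Quotient.ringHom_ext
  refine MvPolynomial.ringHom_ext (fun c => ?_) (fun x => ?_)
  · simp only [RingHom.comp_apply]
    have := scale_toRh_C k (τ k) c
    rw [toRh, RingHom.comp_apply] at this
    rw [ν, this]
  · simp only [RingHom.comp_apply]
    obtain ⟨t, ht⟩ := x
    have e : (X ⟨t, ht⟩ : ChartRing 9 k) = xbar k t := (xbar_of_mem k ht).symm
    have hm : (algebraMap (Rq k) (Rh k)) (Ideal.Quotient.mk (gammaChartIdeal k 9 quadGamma) (X ⟨t, ht⟩)) = m k t := by
      rw [e]; rfl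
    rw [hm, ν, scale_m k (τ k) ht, map_mul, mk_cw, one_mul]

/-- **`mk_J ∘ πJ = id`**: the slice is a retract of the cell along the normalisation.
[cite: Hu2025, Thm. 9.4 p.161; [Hu22] p.131 l.6–16; joint J1 = GAP-LEDGER-HU row HU-R01 (unrefereed preprints under adjudication, D-0012/D-0089 — kernel support on OUR typed carriers of rows 101/110; nothing of the sources asserted)] -/
theorem mk_comp_πJ : (Ideal.Quotient.mk (J k)).comp (πJ k) = RingHom.id (Slice k) := by
  apply Ideal.Quotient.ringHom_ext
  rw [RingHom.comp_assoc, πJ, Ideal.Quotient.lift_comp_mk, mk_comp_ν, RingHom.id_comp]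

/-- **`πJ : Rh ⧸ J → Rh` is injective** (the slice ring is a subring of the cell ring: the torus invariants `ν(Rh)`).
[cite: Hu2025, Thm. 9.4 p.161; [Hu22] p.131 l.6–16; joint J1 = GAP-LEDGER-HU row HU-R01 (unrefereed preprints under adjudication, D-0012/D-0089 — kernel support on OUR typed carriers of rows 101/110; nothing of the sources asserted)] -/
theorem πJ_injective : Function.Injective (πJ k) := by
  intro x y h
  have := congrArg (Ideal.Quotient.mk (J k)) h
  rwa [← RingHom.comp_apply, ← RingHom.comp_apply, mk_comp_πJ, RingHom.id_apply, RingHom.id_apply] at this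

/-- **MAIN (W11a): the slice ring `Rh ⧸ J` — the coordinate ring of `Gr_d/(𝔾⁹_m/𝔾_m)` for the complete quadrilateral — is a
DOMAIN** (`k` of characteristic `0`): it embeds by `πJ` into the domain `Rh` (`GammaQuadCellDomain`). So the torus quotient
`X = Spec (Rh ⧸ J)` of the (integral) cell is INTEGRAL — the `X` of the (β)-reading inhabitant of [Hu22] p.131 — while `Z_{Γ_d}` is
not (`GammaQuadNotIntegral`). OURS; nothing of [Hu25]/[Hu22] asserted.
[cite: Hu2025, Thm. 9.4 («U is isomorphic to the quotient space Gr̄_d := Gr_d/(𝔾ⁿ_m/𝔾_m)») p.161; [Hu22] p.131 l.6–16, l.40–41; joint J1 = GAP-LEDGER-HU row HU-R01 (unrefereed preprints under adjudication, D-0012/D-0089 — kernel support on OUR typed carriers of rows 101/110; nothing of the sources asserted)] -/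
theorem isDomain_slice [CharZero k] : IsDomain (Slice k) := by
  haveI : IsDomain (Rh k) := isDomain_awayGammaChart_quad k
  exact Function.Injective.isDomain (πJ k) (πJ_injective k)

end QuadTorus

end Literature.AlgebraicGeometry.Hu2025.Statements.S03Pluecker

end
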